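import Summits.HodgeConjecture.HodgeConjecture.Theorems.Ring2HypothesesDescentMotivatedSl2Lowering
import Literature.AlgebraicGeometry.HodgeTheory.ComplexBettiKunneth
import Literature.AlgebraicGeometry.HodgeTheory.GysinBaseChange
import Literature.AlgebraicTopology.SingularHomology.CupProductProofs
import HarnessLib

/-!
# Ring 2 hypotheses, descent face — the `𝔰𝔩₂`-triple of a product `X₁ ⊗ X₂` for the exterior sum
# `η₁ ⊠ 1 + 1 ⊠ η₂`, by Künneth transport (real carriers)

research route conditional on HC_CM; not a corollary; Q11.4-sentence-2 already refuted in dim ≥ 3.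
Cell `pub-hodge-ring2` (Hodge ladder STAGE 3), seat `ring2-b05` (binder row b05), gen 34. `HC_CM` does not
occur in this file; nothing here proves a case of the Hodge conjecture.

Step 2 of the port of the elementary `𝔰𝔩₂` proof of the HARD LEFSCHETZ PROPERTY OF AN EXTERIOR SUM
(Kleiman 1968 Thm. 2.9; André 1996 §1.3 "l'isomorphisme de Künneth devient un isomorphisme de `𝔰𝔩₂`-modules";
the tree's abstract `Motives/StandardConjecturesKunnethSl2Proofs`) to the singular cohomology
`H•((X₁ ⊗ X₂)(ℂ); ℂ)` of a product of smooth projective complex varieties — the one input of André's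
Prop. 2.1 (ii), first inclusion, missing on the real carriers
(`Theorems/HeckePrymWeilSummitOffWeilSectorMotivatedPullbackFstBelowMiddle`). For `X₁`, `X₂` smooth
projective of dimensions `n₁`, `n₂`, classes `η₁ ∈ H²(X₁(ℂ))`, `η₂ ∈ H²(X₂(ℂ))`, the exterior sum
`θ = fst^* η₁ + snd^* η₂` and cross products `a ⊠ b = fst^* a ∪ snd^* b`:

* `lefschetzPowTo_boxSum_cross` — **`L_θ (a ⊠ b) = L₁ a ⊠ b + a ⊠ L₂ b`** (graded commutativity, even degrees);
* `kunneth_span_induction` — induction on `Hᵈ((X₁ ⊗ X₂)(ℂ); ℂ)` over cross products (Künneth spanning,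
  the tree's `kunnethSpan_complexBetti`);
* `exists_kunnethEquiv` — the Künneth ISOMORPHISM `⨁_{i+j=d} Hⁱ(X₁(ℂ)) ⊗ Hʲ(X₂(ℂ)) ≃ Hᵈ((X₁ ⊗ X₂)(ℂ))`,
  `a ⊗ b ↦ a ⊠ b` (surjective by spanning, injective by the dimension count `finrank_complexBetti_tensor`);
* `exists_kunnethLowering` — **the transported operator `Λ₁₂ = Λ₁ ⊗ 1 + 1 ⊗ Λ₂`** for two degree-`(-2)`
  families `Λ₁`, `Λ₂` on the factors, characterised on cross products:
  `Λ₁₂ (a ⊠ b) = Λ₁ a ⊠ b + a ⊠ Λ₂ b` (with the degenerate cases in degrees `≤ 1`);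

The `𝔰𝔩₂` relation on the product and the hard Lefschetz property of `θ` follow in the sequel
`Ring2HypothesesDescentMotivatedExteriorSumHardLefschetz`.

No definition, no named fact, no sorry.

References: Kleiman1968AlgebraicCycles (§1.4 (1.4.6), Thm. 2.9), Andre1996Motifs (§1.3 pp. 12–13),
HatcherAT2002 (§3.2 Thm. 3.11, Thm. 3.15–3.16), RamonMari2008LefschetzStandard (Prop. 1.1).
-/

noncomputable section

-- every declaration of this problem lives in `Summit.HodgeConjecture.HodgeConjecture.…` (summit = sub-problem)
set_option linter.dupNamespace false

open CategoryTheory AlgebraicGeometry MonoidalCategory CartesianMonoidalCategory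
open Literature.AlgebraicTopology.SingularHomology Literature.Geometry.Kaehler
open Literature.AlgebraicGeometry Literature.AlgebraicGeometry.Motives
  Literature.AlgebraicGeometry.HodgeTheory
open scoped TensorProduct DirectSum

namespace Summit.HodgeConjecture.HodgeConjecture.Theorems

variable {n₁ n₂ : ℕ} {X₁ X₂ : SchemeOver ℂ}

/-! ## §1 The Lefschetz operator of the exterior sum on cross products -/

/-- `L¹ x = κ ∪ x` with an explicit target degree. [cite: VoisinHodgeI2002, §6.2.3] -/
theorem lefschetzPowTo_one_eq_cupProduct {Y : Type} [TopologicalSpace Y] (κ : singularCohomology ℂ ℂ Y 2)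
    {d e : ℕ} (hde : d + 2 * 1 = e) (h2 : 2 + d = e) (x : singularCohomology ℂ ℂ Y d) :
    lefschetzPowTo κ 1 d e hde x = cupProduct h2 κ x := by
  rw [lefschetzPowTo_succ_apply κ 0 d d e rfl hde h2, lefschetzPowTo_zero_apply, lefschetzOperator_apply]

/-- **The Lefschetz operator of the exterior sum is `L₁ ⊗ 1 + 1 ⊗ L₂`** (Kleiman 1968 Thm. 2.9; André
1996 §1.3): for `θ = fst^* η₁ + snd^* η₂` on `X₁ ⊗ X₂` and a cross product `a ⊠ b = fst^* a ∪ snd^* b`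
(`a ∈ Hⁱ(X₁(ℂ))`, `b ∈ Hʲ(X₂(ℂ))`), `L_θ (a ⊠ b) = L_{η₁} a ⊠ b + a ⊠ L_{η₂} b` — associativity and graded
commutativity of the cup product, the sign being `+1` since `η₂` has even degree.
[cite: Kleiman1968AlgebraicCycles, Thm. 2.9] [cite: HatcherAT2002, §3.2 Thm. 3.11] -/
theorem lefschetzPowTo_boxSum_cross (η₁ : complexBetti X₁ 2) (η₂ : complexBetti X₂ 2)
    {i j d i₂ j₂ e : ℕ} (h : i + j = d) (hi : i + 2 * 1 = i₂) (hj : j + 2 * 1 = j₂) (hde : d + 2 * 1 = e)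
    (h₁ : i₂ + j = e) (h₂ : i + j₂ = e) (a : complexBetti X₁ i) (b : complexBetti X₂ j) :
    lefschetzPowTo (complexBetti.map (fst X₁ X₂) 2 η₁ + complexBetti.map (snd X₁ X₂) 2 η₂) 1 d e hde
        (cupProduct h (complexBetti.map (fst X₁ X₂) i a) (complexBetti.map (snd X₁ X₂) j b)) =
      cupProduct h₁ (complexBetti.map (fst X₁ X₂) i₂ (lefschetzPowTo η₁ 1 i i₂ hi a))
          (complexBetti.map (snd X₁ X₂) j b) +
        cupProduct h₂ (complexBetti.map (fst X₁ X₂) i a)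
          (complexBetti.map (snd X₁ X₂) j₂ (lefschetzPowTo η₂ 1 j j₂ hj b)) := by
  rw [lefschetzPowTo_one_eq_cupProduct _ hde (by omega), map_add, LinearMap.add_apply]
  congr 1
  · -- `fst^* η₁ ∪ (fst^* a ∪ snd^* b) = fst^* (η₁ ∪ a) ∪ snd^* b`
    rw [← cupProduct_assoc (show 2 + i = i₂ by omega) h h₁ (by omega), ← cupProduct_map,
      lefschetzPowTo_one_eq_cupProduct η₁ hi (by omega)]
  · -- `snd^* η₂ ∪ (fst^* a ∪ snd^* b) = fst^* a ∪ snd^* (η₂ ∪ b)`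
    rw [← cupProduct_assoc (show 2 + i = i + 2 by omega) h (show i + 2 + j = e by omega) (by omega),
      cupProduct_gradedComm_holds ℂ (ComplexPoints (X₁ ⊗ X₂)) (show 2 + i = i + 2 by omega) rfl,
      Even.neg_one_pow (even_two_mul i), one_smul,
      cupProduct_assoc rfl (show 2 + j = j₂ by omega) (show i + 2 + j = e by omega) h₂, ← cupProduct_map,
      lefschetzPowTo_one_eq_cupProduct η₂ hj (by omega)]

/-! ## §2 Künneth induction -/

/-- **Künneth induction on `Hᵈ((X₁ ⊗ X₂)(ℂ); ℂ)`**: a property stable under `0`, `+` and scalars which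
holds for all cross products `fst^* a ∪ snd^* b` (`a ∈ Hⁱ(X₁(ℂ))`, `b ∈ Hʲ(X₂(ℂ))`, `i + j = d`) holds
for every class — the cross products span (Künneth, Hatcher Thm. 3.15–3.16; the tree's
`kunnethSpan_complexBetti`). [cite: HatcherAT2002, §3.2 Thm. 3.16] -/
theorem kunneth_span_induction (hX₁ : IsSmoothProjective n₁ X₁) (hX₂ : IsSmoothProjective n₂ X₂) {d : ℕ}
    {motive : complexBetti (X₁ ⊗ X₂) d → Prop} (h0 : motive 0)
    (hadd : ∀ x y, motive x → motive y → motive (x + y)) (hsmul : ∀ (c : ℂ) x, motive x → motive (c • x))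
    (hcross : ∀ (i j : ℕ) (h : i + j = d) (a : complexBetti X₁ i) (b : complexBetti X₂ j),
      motive (cupProduct h (complexBetti.map (fst X₁ X₂) i a) (complexBetti.map (snd X₁ X₂) j b)))
    (x : complexBetti (X₁ ⊗ X₂) d) : motive x := by
  refine Submodule.span_induction (p := fun y _ ↦ motive y) ?_ h0 (fun y z _ _ hy hz ↦ hadd y z hy hz)
    (fun c y _ hy ↦ hsmul c y hy) (kunnethSpan_complexBetti hX₁ hX₂ d x)
  rintro _ ⟨i, j, h, a, b, rfl⟩
  exact hcross i j h a b

/-! ## §3 The Künneth isomorphism `⨁_{i+j=d} Hⁱ(X₁) ⊗ Hʲ(X₂) ≃ Hᵈ(X₁ ⊗ X₂)` -/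

/-- **The Künneth isomorphism for `H*((X₁ ⊗ X₂)(ℂ); ℂ)` in tensor form** (Hatcher Thm. 3.16 with
Cor. A.12): for every `d` there is a `ℂ`-linear equivalence
`⨁_{(i,j) ∈ antidiagonal d} Hⁱ(X₁(ℂ)) ⊗ Hʲ(X₂(ℂ)) ≃ Hᵈ((X₁ ⊗ X₂)(ℂ))` sending `a ⊗ b` in the summand
`(i, j)` to the cross product `fst^* a ∪ snd^* b`. The comparison map is onto (the cross products span,
`kunnethSpan_complexBetti`) between spaces of the same finite dimension
(`b_d(X₁ ⊗ X₂) = Σ_{i+j=d} b_i(X₁) b_j(X₂)`, `finrank_complexBetti_tensor`), hence bijective.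
[cite: HatcherAT2002, §3.2 Thm. 3.16 with Cor. A.12] -/
theorem exists_kunnethEquiv (hX₁ : IsSmoothProjective n₁ X₁) (hX₂ : IsSmoothProjective n₂ X₂) (d : ℕ) :
    ∃ e : (⨁ ij : ↥(Finset.HasAntidiagonal.antidiagonal d), complexBetti X₁ ij.1.1 ⊗[ℂ] complexBetti X₂ ij.1.2) ≃ₗ[ℂ]
        complexBetti (X₁ ⊗ X₂) d,
      ∀ (i j : ℕ) (h : i + j = d) (a : complexBetti X₁ i) (b : complexBetti X₂ j),
        e (DirectSum.lof ℂ _ (fun ij : ↥(Finset.HasAntidiagonal.antidiagonal d) ↦ complexBetti X₁ ij.1.1 ⊗[ℂ] complexBetti X₂ ij.1.2)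
            ⟨(i, j), Finset.HasAntidiagonal.mem_antidiagonal.mpr h⟩ (a ⊗ₜ b)) =
          cupProduct h (complexBetti.map (fst X₁ X₂) i a) (complexBetti.map (snd X₁ X₂) j b) := by
  classical
  haveI := fun i ↦ finite_complexBetti hX₁ i
  haveI := fun j ↦ finite_complexBetti hX₂ j
  haveI := finite_complexBetti (IsSmoothProjective.tensor_holds hX₁ hX₂) d
  -- the comparison map `a ⊗ b ↦ fst^* a ∪ snd^* b`
  let M : ↥(Finset.HasAntidiagonal.antidiagonal d) → Type := fun ij ↦ complexBetti X₁ ij.1.1 ⊗[ℂ] complexBetti X₂ ij.1.2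
  let B : (ij : ↥(Finset.HasAntidiagonal.antidiagonal d)) →
      complexBetti X₁ ij.1.1 →ₗ[ℂ] complexBetti X₂ ij.1.2 →ₗ[ℂ] complexBetti (X₁ ⊗ X₂) d := fun ij ↦
    ((cupProduct (Finset.HasAntidiagonal.mem_antidiagonal.mp ij.2)).comp (complexBetti.map (fst X₁ X₂) ij.1.1).hom).compl₂
      (complexBetti.map (snd X₁ X₂) ij.1.2).hom
  let f : (⨁ ij, M ij) →ₗ[ℂ] complexBetti (X₁ ⊗ X₂) d :=
    DirectSum.toModule ℂ _ _ fun ij ↦ TensorProduct.lift (B ij)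
  have hf : ∀ (i j : ℕ) (h : i + j = d) (a : complexBetti X₁ i) (b : complexBetti X₂ j),
      f (DirectSum.lof ℂ _ M ⟨(i, j), Finset.HasAntidiagonal.mem_antidiagonal.mpr h⟩ (a ⊗ₜ b)) =
        cupProduct h (complexBetti.map (fst X₁ X₂) i a) (complexBetti.map (snd X₁ X₂) j b) := by
    intro i j h a b
    simp only [f, DirectSum.toModule_lof]
    rfl
  -- onto: the cross products span
  have hsurj : Function.Surjective f := by
    rw [← LinearMap.range_eq_top, eq_top_iff]
    intro x _
    refine kunneth_span_induction hX₁ hX₂ (motive := fun y ↦ y ∈ LinearMap.range f) (Submodule.zero_mem _)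
      (fun y z hy hz ↦ Submodule.add_mem _ hy hz) (fun c y hy ↦ Submodule.smul_mem _ c hy)
      (fun i j h a b ↦ ?_) x
    exact ⟨_, hf i j h a b⟩
  -- finite dimension of the source and the dimension count
  let E := DirectSum.linearEquivFunOnFintype ℂ ↥(Finset.HasAntidiagonal.antidiagonal d) M
  haveI : Module.Finite ℂ (⨁ ij, M ij) := Module.Finite.equiv E.symm
  have hdim : Module.finrank ℂ (⨁ ij, M ij) = Module.finrank ℂ (complexBetti (X₁ ⊗ X₂) d) := by
    rw [E.finrank_eq, Module.finrank_pi_fintype, finrank_complexBetti_tensor hX₁ hX₂ d]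
    simp only [M, Module.finrank_tensorProduct]
    rw [Finset.sum_coe_sort (Finset.HasAntidiagonal.antidiagonal d)
        (fun ij : ℕ × ℕ ↦ Module.finrank ℂ (complexBetti X₁ ij.1) * Module.finrank ℂ (complexBetti X₂ ij.2)),
      Finset.Nat.sum_antidiagonal_eq_sum_range_succ
        (fun i j ↦ Module.finrank ℂ (complexBetti X₁ i) * Module.finrank ℂ (complexBetti X₂ j)) d,
      ← Finset.sum_range_reflect _ (d + 1)]
    refine Finset.sum_congr rfl fun j hj ↦ ?_
    rw [Finset.mem_range] at hj
    have h1 : d + 1 - 1 - j = d - j := by omega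
    have h2 : d - (d - j) = j := by omega
    rw [h1, h2]
  have hbij : Function.Bijective f :=
    ⟨(LinearMap.injective_iff_surjective_of_finrank_eq_finrank hdim).mpr hsurj, hsurj⟩
  exact ⟨LinearEquiv.ofBijective f hbij, fun i j h a b ↦ hf i j h a b⟩

/-! ## §4 The transported lowering operator `Λ₁ ⊗ 1 + 1 ⊗ Λ₂` -/

/-- **The lowering operator of the product, `Λ₁₂ = Λ₁ ⊗ 1 + 1 ⊗ Λ₂`, by Künneth transport** (Kleiman
1968 Thm. 2.9: the `𝔰𝔩₂`-triple of a product for the exterior-sum polarisation is the tensor product of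
the triples of the factors): for degree-lowering families `Λ₁ a b : Hᵃ(X₁(ℂ)) → Hᵇ(X₁(ℂ))`,
`Λ₂ a b : Hᵃ(X₂(ℂ)) → Hᵇ(X₂(ℂ))` there is a family `Λ₁₂ m m' : Hᵐ((X₁ ⊗ X₂)(ℂ)) → Hᵐ'((X₁ ⊗ X₂)(ℂ))`
with, on cross products `a ⊠ b` (`a ∈ Hⁱ`, `b ∈ Hʲ`, `i + j = m = m' + 2`):
`Λ₁₂ (a ⊠ b) = Λ₁ a ⊠ b + a ⊠ Λ₂ b` for `i, j ≥ 2` (the two terms in degrees `(i-2) + j` and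
`i + (j-2)`), `= a ⊠ Λ₂ b` for `i ≤ 1`, `= Λ₁ a ⊠ b` for `j ≤ 1`, and `= 0` for `i, j ≤ 1`. Defined
through the Künneth isomorphism (`exists_kunnethEquiv`) as `⨁ (Λ₁ ⊗ 1 + 1 ⊗ Λ₂)`.
[cite: Kleiman1968AlgebraicCycles, Thm. 2.9] [cite: HatcherAT2002, §3.2 Thm. 3.16] -/
theorem exists_kunnethLowering (hX₁ : IsSmoothProjective n₁ X₁) (hX₂ : IsSmoothProjective n₂ X₂)
    (Λ₁ : (a b : ℕ) → complexBetti X₁ a →ₗ[ℂ] complexBetti X₁ b)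
    (Λ₂ : (a b : ℕ) → complexBetti X₂ a →ₗ[ℂ] complexBetti X₂ b) :
    ∃ Λ : (m m' : ℕ) → complexBetti (X₁ ⊗ X₂) m →ₗ[ℂ] complexBetti (X₁ ⊗ X₂) m',
      (∀ (i j m m' i' j' : ℕ) (h : i + j = m) (_ : i' + 2 = i) (_ : j' + 2 = j) (h₁ : i' + j = m')
        (h₂ : i + j' = m') (a : complexBetti X₁ i) (b : complexBetti X₂ j),
        Λ m m' (cupProduct h (complexBetti.map (fst X₁ X₂) i a) (complexBetti.map (snd X₁ X₂) j b)) =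
          cupProduct h₁ (complexBetti.map (fst X₁ X₂) i' (Λ₁ i i' a)) (complexBetti.map (snd X₁ X₂) j b) +
            cupProduct h₂ (complexBetti.map (fst X₁ X₂) i a) (complexBetti.map (snd X₁ X₂) j' (Λ₂ j j' b))) ∧
      (∀ (i j m m' j' : ℕ) (h : i + j = m) (_ : m' + 2 = m) (_ : i ≤ 1) (_ : j' + 2 = j) (h₂ : i + j' = m')
        (a : complexBetti X₁ i) (b : complexBetti X₂ j),
        Λ m m' (cupProduct h (complexBetti.map (fst X₁ X₂) i a) (complexBetti.map (snd X₁ X₂) j b)) =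
          cupProduct h₂ (complexBetti.map (fst X₁ X₂) i a) (complexBetti.map (snd X₁ X₂) j' (Λ₂ j j' b))) ∧
      (∀ (i j m m' i' : ℕ) (h : i + j = m) (_ : m' + 2 = m) (_ : i' + 2 = i) (_ : j ≤ 1) (h₁ : i' + j = m')
        (a : complexBetti X₁ i) (b : complexBetti X₂ j),
        Λ m m' (cupProduct h (complexBetti.map (fst X₁ X₂) i a) (complexBetti.map (snd X₁ X₂) j b)) =
          cupProduct h₁ (complexBetti.map (fst X₁ X₂) i' (Λ₁ i i' a)) (complexBetti.map (snd X₁ X₂) j b)) ∧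
      (∀ (i j m m' : ℕ) (h : i + j = m) (_ : m' + 2 = m) (_ : i ≤ 1) (_ : j ≤ 1)
        (a : complexBetti X₁ i) (b : complexBetti X₂ j),
        Λ m m' (cupProduct h (complexBetti.map (fst X₁ X₂) i a) (complexBetti.map (snd X₁ X₂) j b)) = 0) := by
  classical
  choose e he using exists_kunnethEquiv hX₁ hX₂
  -- the cross product as a bilinear map `Hⁱ'(X₁) × Hʲ'(X₂) → Hᵐ'(X₁ ⊗ X₂)`
  let cross : (i' j' m' : ℕ) → (i' + j' = m') →
      complexBetti X₁ i' →ₗ[ℂ] complexBetti X₂ j' →ₗ[ℂ] complexBetti (X₁ ⊗ X₂) m' := fun i' j' m' h ↦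
    ((cupProduct h).comp (complexBetti.map (fst X₁ X₂) i').hom).compl₂ (complexBetti.map (snd X₁ X₂) j').hom
  have cross_apply : ∀ (i' j' m' : ℕ) (h : i' + j' = m') (a : complexBetti X₁ i') (b : complexBetti X₂ j'),
      cross i' j' m' h a b =
        cupProduct h (complexBetti.map (fst X₁ X₂) i' a) (complexBetti.map (snd X₁ X₂) j' b) :=
    fun _ _ _ _ _ _ ↦ rfl
  -- `(Λ₁ a) ⊠ b` and `a ⊠ (Λ₂ b)` as bilinear maps into `Hᵐ'`
  let Ext₁ : (m' i j : ℕ) → complexBetti X₁ i →ₗ[ℂ] complexBetti X₂ j →ₗ[ℂ] complexBetti (X₁ ⊗ X₂) m' :=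
    fun m' i j ↦ ∑ i' ∈ Finset.range i, if h : i' + j = m' then (cross i' j m' h).comp (Λ₁ i i') else 0
  let Ext₂ : (m' i j : ℕ) → complexBetti X₁ i →ₗ[ℂ] complexBetti X₂ j →ₗ[ℂ] complexBetti (X₁ ⊗ X₂) m' :=
    fun m' i j ↦ ∑ j' ∈ Finset.range j, if h : i + j' = m' then (cross i j' m' h).compl₂ (Λ₂ j j') else 0
  have Ext₁_apply : ∀ {m' i j i' : ℕ} (_ : i' + 2 = i) (h₁ : i' + j = m') (a : complexBetti X₁ i)
      (b : complexBetti X₂ j), Ext₁ m' i j a b =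
        cupProduct h₁ (complexBetti.map (fst X₁ X₂) i' (Λ₁ i i' a)) (complexBetti.map (snd X₁ X₂) j b) := by
    intro m' i j i' hi h₁ a b
    simp only [Ext₁]
    rw [LinearMap.sum_apply, LinearMap.sum_apply,
      Finset.sum_eq_single_of_mem i' (Finset.mem_range.mpr (by omega))]
    · rw [dif_pos h₁]
      rfl
    · intro i'' _ hne
      have hne' : ¬ i'' + j = m' := by omega
      rw [dif_neg hne', LinearMap.zero_apply, LinearMap.zero_apply]
  have Ext₁_zero : ∀ {m' i j : ℕ} (_ : i ≤ 1) (_ : i + j = m' + 2) (a : complexBetti X₁ i)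
      (b : complexBetti X₂ j), Ext₁ m' i j a b = 0 := by
    intro m' i j hi hij a b
    simp only [Ext₁]
    rw [LinearMap.sum_apply, LinearMap.sum_apply]
    refine Finset.sum_eq_zero fun i'' hi'' ↦ ?_
    have hne : ¬ i'' + j = m' := by
      have := Finset.mem_range.mp hi''
      omega
    rw [dif_neg hne, LinearMap.zero_apply, LinearMap.zero_apply]
  have Ext₂_apply : ∀ {m' i j j' : ℕ} (_ : j' + 2 = j) (h₂ : i + j' = m') (a : complexBetti X₁ i)
      (b : complexBetti X₂ j), Ext₂ m' i j a b =
        cupProduct h₂ (complexBetti.map (fst X₁ X₂) i a) (complexBetti.map (snd X₁ X₂) j' (Λ₂ j j' b)) := by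
    intro m' i j j' hj h₂ a b
    simp only [Ext₂]
    rw [LinearMap.sum_apply, LinearMap.sum_apply,
      Finset.sum_eq_single_of_mem j' (Finset.mem_range.mpr (by omega))]
    · rw [dif_pos h₂]
      rfl
    · intro j'' _ hne
      have hne' : ¬ i + j'' = m' := by omega
      rw [dif_neg hne', LinearMap.zero_apply, LinearMap.zero_apply]
  have Ext₂_zero : ∀ {m' i j : ℕ} (_ : j ≤ 1) (_ : i + j = m' + 2) (a : complexBetti X₁ i)
      (b : complexBetti X₂ j), Ext₂ m' i j a b = 0 := by
    intro m' i j hj hij a b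
    simp only [Ext₂]
    rw [LinearMap.sum_apply, LinearMap.sum_apply]
    refine Finset.sum_eq_zero fun j'' hj'' ↦ ?_
    have hne : ¬ i + j'' = m' := by
      have := Finset.mem_range.mp hj''
      omega
    rw [dif_neg hne, LinearMap.zero_apply, LinearMap.zero_apply]
  -- the operator
  let Λ : (m m' : ℕ) → complexBetti (X₁ ⊗ X₂) m →ₗ[ℂ] complexBetti (X₁ ⊗ X₂) m' := fun m m' ↦
    (DirectSum.toModule ℂ _ _ fun ij : ↥(Finset.HasAntidiagonal.antidiagonal m) ↦
        TensorProduct.lift (Ext₁ m' ij.1.1 ij.1.2 + Ext₂ m' ij.1.1 ij.1.2)) ∘ₗ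
      (e m).symm.toLinearMap
  have hΛ : ∀ {i j m m' : ℕ} (h : i + j = m) (a : complexBetti X₁ i) (b : complexBetti X₂ j),
      Λ m m' (cupProduct h (complexBetti.map (fst X₁ X₂) i a) (complexBetti.map (snd X₁ X₂) j b)) =
        Ext₁ m' i j a b + Ext₂ m' i j a b := by
    intro i j m m' h a b
    simp only [Λ, LinearMap.coe_comp, LinearEquiv.coe_coe, Function.comp_apply]
    rw [← he m i j h a b, LinearEquiv.symm_apply_apply, DirectSum.toModule_lof, TensorProduct.lift.tmul,
      LinearMap.add_apply, LinearMap.add_apply]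
  refine ⟨Λ, ?_, ?_, ?_, ?_⟩
  · intro i j m m' i' j' h hi hj h₁ h₂ a b
    rw [hΛ h, Ext₁_apply hi h₁, Ext₂_apply hj h₂]
  · intro i j m m' j' h hm hi hj h₂ a b
    rw [hΛ h, Ext₁_zero hi (by omega), Ext₂_apply hj h₂, zero_add]
  · intro i j m m' i' h hm hi hj h₁ a b
    rw [hΛ h, Ext₁_apply hi h₁, Ext₂_zero hj (by omega), add_zero]
  · intro i j m m' h hm hi hj a b
    rw [hΛ h, Ext₁_zero hi (by omega), Ext₂_zero hj (by omega), add_zero]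

end Summit.HodgeConjecture.HodgeConjecture.Theorems

end
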